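import Mathlib
import Summits.MatrixMultiplication.MatrixMultiplication.Theorems.SnSubsetDichotomyPolynomialSlackMarginals
import Summits.MatrixMultiplication.MatrixMultiplication.Theorems.SnSubsetDichotomyPolynomialSlackPositivity

/-!
# Parseval bound for the profile of a quotient set

Crux `Summit.MatrixMultiplication.MatrixMultiplication.Theses.SnSubsetDichotomy.PolynomialSlack`
(item `stmt-MatrixMultiplication-8306`), level-one programme, line transport-split-hull (lead c6).
For `X, Y ⊆ S_n` with `(x,y) ↦ x⁻¹y` injective on `X × Y`, the PROFILE of the quotient set `X⁻¹Y`
is the array `d(i,j) = m_{XY}(i,j)/(|X||Y|)`, `m_{XY}(i,j) = #{(x,y) ∈ X × Y : y j = x i}` the pair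
marginal (all row and column sums `|X||Y|`, `sum_pairMarginal_snd/fst`), so `d` has unit row sums.
The PARSEVAL bound of this file is

  `(n-1)·Σ_{i,j} (d(i,j) - 1/n)² ≤ n!/(|X||Y|)`      (`pair_parseval`),

i.e. the centred energy of the profile is at most the co-density `K = n!/|X⁻¹Y|` over `n - 1`.
Proof: the excess cap `excess_cap_pair` (`(n-1)·Σ m² ≤ |X||Y|·(n! + (n-2)|X||Y|)`) divided by
`(|X||Y|)²` gives `(n-1)·Σ d² ≤ n!/(|X||Y|) + (n-2)`, and centring (`sumSq_centered_eq`, unit row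
sums) gives `Σ (d - 1/n)² = Σ d² - 1`, whence `(n-1)·Σ (d-1/n)² ≤ n!/(|X||Y|) - 1`.
-/

namespace Summit.MatrixMultiplication.MatrixMultiplication.Theorems.PolynomialSlack

set_option linter.dupNamespace false

open scoped BigOperators

/-- **Parseval bound for quotient profiles.** If `(x,y) ↦ x⁻¹y` is injective on `X × Y ⊆ S_n × S_n`
(`n ≥ 40`, `X, Y` non-empty) and `d(i,j) = #{(x,y) ∈ X × Y : y j = x i}/(|X||Y|)` is the profile of
`X⁻¹Y`, then `(n-1)·Σ_{i,j} (d(i,j) - 1/n)² ≤ n!/(|X||Y|)`. Proof: `excess_cap_pair` divided by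
`(|X||Y|)²`, then `sumSq_centered_eq` (row sums of `d` are `1` by `sum_pairMarginal_snd`). [folklore] -/
theorem pair_parseval {n : ℕ} (hn : 40 ≤ n) (X Y : Finset (Equiv.Perm (Fin n))) (hX : X.Nonempty)
    (hY : Y.Nonempty)
    (hinj : Set.InjOn (fun xy : Equiv.Perm (Fin n) × Equiv.Perm (Fin n) => xy.1⁻¹ * xy.2)
      (↑X ×ˢ ↑Y : Set (Equiv.Perm (Fin n) × Equiv.Perm (Fin n))))
    (d : Fin n → Fin n → ℝ)
    (hd : ∀ i j, d i j =
      (((X ×ˢ Y).filter fun xy => xy.2 j = xy.1 i).card : ℝ) / (X.card * Y.card : ℕ)) :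
    ((n : ℝ) - 1) * ∑ i : Fin n, ∑ j : Fin n, (d i j - 1 / n) ^ 2 ≤
      (n.factorial : ℝ) / (X.card * Y.card : ℕ) := by
  -- the excess cap `(n-1)·Σ m² ≤ α·(n! + (n-2)·α)`, `α = |X||Y|`
  have hcap := excess_cap_pair hn hinj
  set S : ℝ := ∑ i : Fin n, ∑ j : Fin n,
    (((X ×ˢ Y).filter fun xy => xy.2 j = xy.1 i).card : ℝ) ^ 2 with hS
  set α : ℝ := ((X.card * Y.card : ℕ) : ℝ) with hα
  have hα0 : 0 < α := by
    rw [hα]; exact_mod_cast Nat.mul_pos hX.card_pos hY.card_pos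
  have hn0 : n ≠ 0 := by omega
  -- row sums of the profile are `1`
  have hrow : ∀ i, ∑ j : Fin n, d i j = 1 := by
    intro i
    simp_rw [hd i]
    rw [← Finset.sum_div, div_eq_one_iff_eq hα0.ne', hα]
    exact_mod_cast sum_pairMarginal_snd X Y i
  -- `Σ d² = Σ m² / α²`
  have hsq : ∑ i : Fin n, ∑ j : Fin n, d i j ^ 2 = S / α ^ 2 := by
    rw [hS, Finset.sum_div]
    refine Finset.sum_congr rfl fun i _ => ?_
    rw [Finset.sum_div]
    refine Finset.sum_congr rfl fun j _ => ?_
    rw [hd i j, div_pow]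
  -- `(n-1)·Σ d² ≤ n!/α + (n-2)`
  have key : ((n : ℝ) - 1) * (S / α ^ 2) ≤ (n.factorial : ℝ) / α + ((n : ℝ) - 2) := by
    have e1 : ((n : ℝ) - 1) * (S / α ^ 2) = ((n : ℝ) - 1) * S / α ^ 2 := by ring
    have e2 : (n.factorial : ℝ) / α + ((n : ℝ) - 2) =
        α * ((n.factorial : ℝ) + ((n : ℝ) - 2) * α) / α ^ 2 := by
      field_simp
    rw [e1, e2]
    exact div_le_div_of_nonneg_right hcap (pow_pos hα0 2).le
  -- centring: `Σ (d - 1/n)² = Σ d² - 1`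
  rw [sumSq_centered_eq hn0 d hrow, hsq, mul_sub, mul_one]
  have hn1 : (40 : ℝ) ≤ n := by exact_mod_cast hn
  linarith [key, hn1]

end Summit.MatrixMultiplication.MatrixMultiplication.Theorems.PolynomialSlack
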